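import Summits.QuantumFields.YangMills.Theorems.F4SubCurvatureDoorNullConePointedness
import Mathlib
import HarnessLib

/-!
# Route `F4SubCurvatureDoor`, crux ⟨stmt-QuantumFields-23125⟩ `RationalToGeneral`: LINE g18-A v5 «top-channel cone cut» —
# CSF build-plan brick C1: a harmonic polynomial on `ℝ⁴` vanishing on a sphere is zero (def-free)

Owner ym-idea-3 g18's build plan for the registered stub `stub_channelShellForm` (`Lines/sextic_channel_stubplans.md` §4, commit
060b407781dd) lists as brick **C1**: «a harmonic polynomial vanishing on a sphere is `0`» (it pins the harmonic channel
components down by pointwise linear algebra; critic idea-crit-4 03:40Z: classical and true, S/M−).  This file proves it, purely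
algebraically (no maximum principle, no `‖x‖·Poly` splitting):

**Theorem** (`eq_zero_of_laplacian_eq_zero_of_eval_sphere_eq_zero`).  If `P ∈ ℝ[x₀,…,x₃]` satisfies `Σᵢ ∂ᵢ²P = 0` and
`P(x) = 0` for every `x ∈ ℝ⁴` with `‖x‖ = r` (`r > 0`), then `P = 0`.

Proof.  (1) `∂ᵢ` lowers homogeneous components by one (`pderiv_homogeneousComponent_succ`, from `coeff_pderiv` and
`coeff_homogeneousComponent`), so every homogeneous component `P_k` of a harmonic `P` is harmonic
(`laplacian_homogeneousComponent`).  (2) Parity: `P(−x) = Σ_k (−1)^k P_k(x)` (`eval_neg_eq_sum`), so on the sphere both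
`Σ_j P_{2j}(x) = 0` and `Σ_j P_{2j+1}(x) = 0`.  (3) Homogenise with `q = Σᵢ Xᵢ²`, which equals `r²` on the sphere:
`Ẽ = Σ_{j ≤ N} r^{−2(N−j)} P_{2j} q^{N−j}` (homogeneous of degree `2N`) and `Õ = Σ_{j ≤ N} r^{−2(N−j)} P_{2j+1} q^{N−j}` (degree
`2N+1`) vanish on the sphere, hence on every ray, hence are the zero polynomial (`eq_zero_of_isHomogeneous_of_eval_sphere_eq_zero`).
(4) Descent (`eq_zero_of_sum_mul_pow_nullForm_eq_zero`): if `Σ_{j ≤ m} H_j q^{m−j} = 0` with all `H_j` harmonic then all `H_j = 0` —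
the top term `H_m` lies in the ideal `(q)` and is harmonic, so it vanishes by the tree's Fischer decomposition `ℋ ∩ 𝒫·q = 0`
(`Literature.Algebra.Polynomial.FischerDecomposition.disjoint_harmonic_span`, Goodman–Wallach Lemma 5.1.5); cancel `q` and induct.
Hence every `P_k = 0` and `P = Σ_k P_k = 0`.

Mathlib + the tree's Fischer file (through `F4SubCurvatureDoorNullConePointedness`, whose `algHom_pderiv_nullForm_apply` is reused); THEOREMS ONLY (no definitions); no named facts; no `sorry`; default heartbeats.
HONEST FRAMING: one classical algebra brick (C1) of the build plan of an OPEN stub (`ChannelShellForm`, whose pole C3 is XL);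
nothing about the wall T1″, C3, crux 23125 / 23035, rung R2d or the summit is proved here; the Yang–Mills mass gap is NOT
proved.  Fleet seat `ym-spine-19353-p1` g24 (free capacity; announced on the owner's bus 2026-08-29T03:48Z),
`--supports stmt-QuantumFields-23125`. [cite: GoodmanWallachGTM255, §5.1.2 Lemma 5.1.5]
-/

set_option autoImplicit false

noncomputable section

namespace Summit.QuantumFields.YangMills.Theorems.F4SubCurvatureDoorHarmonicSphere

open MvPolynomial
open scoped BigOperators

/-! ## §1 Homogeneous components of harmonic polynomials are harmonic -/

section Components

variable {σ : Type*}

/-- `∂ᵢ (P)_{k+1} = (∂ᵢ P)_k`: a partial derivative lowers homogeneous components by one. [folklore] -/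
theorem pderiv_homogeneousComponent_succ (i : σ) (k : ℕ) (P : MvPolynomial σ ℝ) :
    pderiv i (homogeneousComponent (k + 1) P) = homogeneousComponent k (pderiv i P) := by
  classical
  ext m
  rw [coeff_pderiv, coeff_homogeneousComponent, coeff_homogeneousComponent, coeff_pderiv]
  have hdeg : (m + Finsupp.single i 1).degree = m.degree + 1 := by
    rw [map_add, Finsupp.degree_single]
  rw [hdeg]
  by_cases hm : m.degree = k
  · rw [if_pos (by rw [hm]), if_pos hm]
  · rw [if_neg (fun h => hm (Nat.succ_injective h)), if_neg hm, zero_mul]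

/-- `∂ᵢ (P)₀ = 0`. [folklore] -/
theorem pderiv_homogeneousComponent_zero (i : σ) (P : MvPolynomial σ ℝ) :
    pderiv i (homogeneousComponent 0 P) = 0 := by
  rw [homogeneousComponent_zero, pderiv_C]

variable [Fintype σ]

/-- **Homogeneous components of a harmonic polynomial are harmonic**: `Δ (P)_{k+2} = (Δ P)_k` and `Δ (P)₀ = Δ (P)₁ = 0`, so
`Δ P = 0 ⇒ Δ (P)_k = 0` for every `k`. [folklore] -/
theorem laplacian_homogeneousComponent (P : MvPolynomial σ ℝ) (hΔ : ∑ i, pderiv i (pderiv i P) = 0) (k : ℕ) :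
    ∑ i, pderiv i (pderiv i (homogeneousComponent k P)) = 0 := by
  rcases k with _ | k
  · simp only [pderiv_homogeneousComponent_zero, map_zero, Finset.sum_const_zero]
  rcases k with _ | k
  · simp only [zero_add, pderiv_homogeneousComponent_succ, pderiv_homogeneousComponent_zero, Finset.sum_const_zero]
  · have h : ∀ i, pderiv i (pderiv i (homogeneousComponent (k + 1 + 1) P)) =
        homogeneousComponent k (pderiv i (pderiv i P)) := fun i => by
      rw [pderiv_homogeneousComponent_succ, pderiv_homogeneousComponent_succ]
    simp only [h]
    rw [← map_sum, hΔ, map_zero]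

/-- Scalar multiples of harmonic polynomials are harmonic. [folklore] -/
theorem laplacian_C_mul (c : ℝ) (P : MvPolynomial σ ℝ) (hΔ : ∑ i, pderiv i (pderiv i P) = 0) :
    ∑ i, pderiv i (pderiv i (C c * P)) = 0 := by
  simp only [pderiv_C_mul]
  rw [← Finset.mul_sum, hΔ, mul_zero]

end Components

/-! ## §2 Evaluation on rays and parity -/

section Eval

variable {σ : Type*}

/-- `φ(c•x) = c^n φ(x)` for `φ` homogeneous of degree `n`. [folklore] -/
theorem eval_smul_of_isHomogeneous {φ : MvPolynomial σ ℝ} {n : ℕ} (hφ : φ.IsHomogeneous n) (c : ℝ) (x : σ → ℝ) :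
    eval (fun i => c * x i) φ = c ^ n * eval x φ := by
  classical
  rw [eval_eq, eval_eq, Finset.mul_sum]
  refine Finset.sum_congr rfl fun d hd => ?_
  have hdn : d.degree = n := by
    have h := hφ (mem_support_iff.mp hd)
    rw [← h]
    exact congrFun (congrArg DFunLike.coe Finsupp.degree_eq_weight_one) d
  have hprod : ∏ i ∈ d.support, (c * x i) ^ d i = c ^ n * ∏ i ∈ d.support, x i ^ d i := by
    simp only [mul_pow]
    rw [Finset.prod_mul_distrib, Finset.prod_pow_eq_pow_sum, ← Finsupp.degree_apply, hdn]
  rw [hprod]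
  ring

/-- Negation: `φ(−x) = (−1)^n φ(x)` for `φ` homogeneous of degree `n`. [folklore] -/
theorem eval_neg_of_isHomogeneous {φ : MvPolynomial σ ℝ} {n : ℕ} (hφ : φ.IsHomogeneous n) (x : σ → ℝ) :
    eval (fun i => -x i) φ = (-1) ^ n * eval x φ := by
  have h := eval_smul_of_isHomogeneous hφ (-1) x
  simp only [neg_mul, one_mul] at h
  exact h

end Eval

/-! ## §3 Homogeneous polynomials vanishing on a sphere; the descent through the Fischer decomposition -/

section Sphere

/-- The null form `q = Σᵢ Xᵢ²` evaluates to `‖x‖²` on `ℝ⁴`. [folklore] -/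
theorem eval_nullForm (x : EuclideanSpace ℝ (Fin 4)) :
    eval (fun i => x i) (∑ i : Fin 4, X i ^ 2 : MvPolynomial (Fin 4) ℝ) = ‖x‖ ^ 2 := by
  rw [EuclideanSpace.real_norm_sq_eq, map_sum]
  simp only [map_pow, eval_X]

/-- **A homogeneous polynomial vanishing on a sphere of positive radius vanishes identically.** [folklore] -/
theorem eq_zero_of_isHomogeneous_of_eval_sphere_eq_zero {H : MvPolynomial (Fin 4) ℝ} {n : ℕ} (hH : H.IsHomogeneous n)
    {r : ℝ} (hr : 0 < r) (hS : ∀ x : EuclideanSpace ℝ (Fin 4), ‖x‖ = r → eval (fun i => x i) H = 0) :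
    H = 0 := by
  -- a point on the sphere
  obtain ⟨x₁, hx₁⟩ := exists_ne (0 : EuclideanSpace ℝ (Fin 4))
  have hx₁n : 0 < ‖x₁‖ := norm_pos_iff.mpr hx₁
  set e : EuclideanSpace ℝ (Fin 4) := (r / ‖x₁‖) • x₁ with he
  have hen : ‖e‖ = r := by
    rw [he, norm_smul, Real.norm_eq_abs, abs_of_pos (div_pos hr hx₁n), div_mul_cancel₀ r hx₁n.ne']
  -- `H` vanishes at every point of `ℝ⁴`
  have key : ∀ x : EuclideanSpace ℝ (Fin 4), eval (fun i => x i) H = 0 := by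
    intro x
    by_cases hx0 : x = 0
    · have hxe : (fun i => x i) = fun i => (0 : ℝ) * e i := by
        funext i
        simp [hx0]
      rw [hxe, eval_smul_of_isHomogeneous hH]
      rcases Nat.eq_zero_or_pos n with hn | hn
      · subst hn
        rw [pow_zero, one_mul]
        exact hS e hen
      · rw [zero_pow hn.ne', zero_mul]
    · have hnx : 0 < ‖x‖ := norm_pos_iff.mpr hx0
      set c : ℝ := ‖x‖ / r with hc
      have hcpos : 0 < c := div_pos hnx hr
      set z : EuclideanSpace ℝ (Fin 4) := c⁻¹ • x with hz
      have hzn : ‖z‖ = r := by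
        rw [hz, norm_smul, Real.norm_eq_abs, abs_of_pos (inv_pos.mpr hcpos), hc, inv_div]
        field_simp
      have hxz : (fun i => x i) = fun i => c * z i := by
        funext i
        rw [hz, PiLp.smul_apply, smul_eq_mul, ← mul_assoc, mul_inv_cancel₀ hcpos.ne', one_mul]
      rw [hxz, eval_smul_of_isHomogeneous hH, hS z hzn, mul_zero]
  apply MvPolynomial.funext
  intro y
  rw [map_zero]
  have h := key ((WithLp.equiv 2 (Fin 4 → ℝ)).symm y)
  have hxy : (fun i => ((WithLp.equiv 2 (Fin 4 → ℝ)).symm y) i) = y := by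
    funext i
    simp
  rwa [hxy] at h

/-- **Fischer**: a harmonic polynomial in the ideal of the null form is zero (`ℋ ∩ 𝒫·q = 0`, tree `disjoint_harmonic_span`).
[cite: GoodmanWallachGTM255, §5.1.2 Lemma 5.1.5] -/
theorem eq_zero_of_laplacian_eq_zero_of_nullForm_dvd (P Q : MvPolynomial (Fin 4) ℝ)
    (hΔ : ∑ i, pderiv i (pderiv i P) = 0) (hPQ : P = (∑ i : Fin 4, X i ^ 2) * Q) : P = 0 := by
  obtain ⟨D, hD⟩ :=
    Literature.Algebra.Polynomial.FischerDecomposition.exists_algHom_pderiv (ι := Fin 4)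
  have hdisj :=
    Literature.Algebra.Polynomial.FischerDecomposition.disjoint_harmonic_span D hD
      ({∑ i : Fin 4, X i ^ 2} : Set (MvPolynomial (Fin 4) ℝ))
  rw [Submodule.disjoint_def] at hdisj
  refine hdisj P ?_ ?_
  · simp only [Submodule.mem_iInf, Set.mem_singleton_iff]
    rintro g rfl
    rw [LinearMap.mem_ker, Summit.QuantumFields.YangMills.Theorems.F4SubCurvatureDoorNullCone.algHom_pderiv_nullForm_apply D hD, hΔ]
  · rw [Submodule.restrictScalars_mem, hPQ]
    exact Ideal.mul_mem_right _ _ (Ideal.subset_span rfl)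

/-- The null form is not the zero polynomial. [folklore] -/
theorem nullForm_ne_zero : (∑ i : Fin 4, X i ^ 2 : MvPolynomial (Fin 4) ℝ) ≠ 0 := by
  intro h
  have h1 := congrArg (eval fun _ : Fin 4 => (1 : ℝ)) h
  simp only [map_sum, map_pow, eval_X, one_pow, Finset.sum_const, Finset.card_univ, Fintype.card_fin,
    nsmul_eq_mul, mul_one, map_zero] at h1
  norm_num at h1

/-- **Descent lemma**: if `Σ_{j ≤ m} H_j q^{m−j} = 0` with every `H_j` harmonic, then every `H_j = 0` (`q = Σᵢ Xᵢ²`):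
the top term is a harmonic element of the ideal `(q)`, hence `0` by Fischer; cancel `q` and induct.
[cite: GoodmanWallachGTM255, §5.1.2 Lemma 5.1.5] -/
theorem eq_zero_of_sum_mul_pow_nullForm_eq_zero :
    ∀ (m : ℕ) (H : ℕ → MvPolynomial (Fin 4) ℝ), (∀ j, j ≤ m → ∑ i, pderiv i (pderiv i (H j)) = 0) →
      (∑ j ∈ Finset.range (m + 1), H j * (∑ i : Fin 4, X i ^ 2) ^ (m - j)) = 0 →
      ∀ j, j ≤ m → H j = 0 := by
  intro m
  induction m with
  | zero =>
    intro H _ hsum j hj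
    obtain rfl : j = 0 := Nat.le_zero.mp hj
    simpa using hsum
  | succ m ih =>
    intro H hH hsum j hj
    set q : MvPolynomial (Fin 4) ℝ := ∑ i : Fin 4, X i ^ 2 with hq
    -- split off the top term
    have hsplit : (∑ j ∈ Finset.range (m + 1 + 1), H j * q ^ (m + 1 - j))
        = q * (∑ j ∈ Finset.range (m + 1), H j * q ^ (m - j)) + H (m + 1) := by
      rw [Finset.sum_range_succ, Nat.sub_self, pow_zero, mul_one, Finset.mul_sum]
      congr 1
      refine Finset.sum_congr rfl fun j hj => ?_
      have hjm : j ≤ m := Nat.lt_succ_iff.mp (Finset.mem_range.mp hj)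
      rw [Nat.succ_sub hjm, pow_succ]
      ring
    rw [hsplit] at hsum
    -- the top term is harmonic and lies in `(q)`
    have htop : H (m + 1) = 0 := by
      refine eq_zero_of_laplacian_eq_zero_of_nullForm_dvd (H (m + 1))
        (-(∑ j ∈ Finset.range (m + 1), H j * q ^ (m - j))) (hH _ le_rfl) ?_
      rw [mul_neg]
      exact eq_neg_of_add_eq_zero_right hsum
    -- cancel `q` and induct
    have hrest : (∑ j ∈ Finset.range (m + 1), H j * q ^ (m - j)) = 0 := by
      rw [htop, add_zero] at hsum
      rcases mul_eq_zero.mp hsum with h | h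
      · exact absurd h nullForm_ne_zero
      · exact h
    rcases Nat.lt_or_eq_of_le hj with hlt | heq
    · exact ih H (fun j hj' => hH j (hj'.trans (Nat.le_succ m))) hrest j (Nat.lt_succ_iff.mp hlt)
    · rw [heq]; exact htop

end Sphere

/-! ## §4 The theorem -/

/-- Splitting a sum over `range (2M)` into its even and odd parts. [folklore] -/
theorem sum_range_two_mul (f : ℕ → ℝ) (M : ℕ) :
    (∑ k ∈ Finset.range (2 * M), f k) = (∑ j ∈ Finset.range M, f (2 * j)) + ∑ j ∈ Finset.range M, f (2 * j + 1) := by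
  induction M with
  | zero => simp
  | succ M ih =>
    rw [show 2 * (M + 1) = 2 * M + 1 + 1 by ring, Finset.sum_range_succ, Finset.sum_range_succ, ih,
      Finset.sum_range_succ, Finset.sum_range_succ]
    ring

/-- **One parity class**: if `P` is harmonic and `Σ_{j ≤ N} P_{2j+b}(x) = 0` on the sphere `‖x‖ = r` (`b` a fixed offset), then
`P_{2j+b} = 0` for all `j ≤ N` — homogenise with powers of `q/r²` and descend through the Fischer decomposition.
[cite: GoodmanWallachGTM255, §5.1.2 Lemma 5.1.5] -/
theorem homogeneousComponent_eq_zero_of_parity (P : MvPolynomial (Fin 4) ℝ) (hΔ : ∑ i, pderiv i (pderiv i P) = 0)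
    {r : ℝ} (hr : 0 < r) (N b : ℕ)
    (hvan : ∀ x : EuclideanSpace ℝ (Fin 4), ‖x‖ = r →
      (∑ j ∈ Finset.range (N + 1), eval (fun i => x i) (homogeneousComponent (2 * j + b) P)) = 0) :
    ∀ j, j ≤ N → homogeneousComponent (2 * j + b) P = 0 := by
  set q : MvPolynomial (Fin 4) ℝ := ∑ i : Fin 4, X i ^ 2 with hq
  have hr2 : (r ^ 2) ≠ 0 := pow_ne_zero 2 hr.ne'
  -- the rescaled components
  set He : ℕ → MvPolynomial (Fin 4) ℝ := fun j => C ((r ^ 2)⁻¹ ^ (N - j)) * homogeneousComponent (2 * j + b) P with hHe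
  have hHe_harm : ∀ j, j ≤ N → ∑ i, pderiv i (pderiv i (He j)) = 0 := fun j _ =>
    laplacian_C_mul _ _ (laplacian_homogeneousComponent P hΔ _)
  -- the homogenised polynomial
  have hq2 : q.IsHomogeneous 2 := by
    refine IsHomogeneous.sum _ _ _ fun i _ => ?_
    exact isHomogeneous_X_pow i 2
  have hhom : (∑ j ∈ Finset.range (N + 1), He j * q ^ (N - j)).IsHomogeneous (2 * N + b) := by
    refine IsHomogeneous.sum _ _ _ fun j hj => ?_
    have hjN : j ≤ N := Nat.lt_succ_iff.mp (Finset.mem_range.mp hj)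
    have h1 : (He j).IsHomogeneous (2 * j + b) := (homogeneousComponent_isHomogeneous (2 * j + b) P).C_mul _
    have h2 : (q ^ (N - j)).IsHomogeneous (2 * (N - j)) := hq2.pow (N - j)
    have h3 := h1.mul h2
    rwa [show 2 * j + b + 2 * (N - j) = 2 * N + b by omega] at h3
  have hvan' : ∀ x : EuclideanSpace ℝ (Fin 4), ‖x‖ = r →
      eval (fun i => x i) (∑ j ∈ Finset.range (N + 1), He j * q ^ (N - j)) = 0 := by
    intro x hx
    rw [map_sum, ← hvan x hx]
    refine Finset.sum_congr rfl fun j _ => ?_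
    rw [map_mul, map_mul, eval_C, map_pow, hq, eval_nullForm, hx]
    have h : ((r ^ 2)⁻¹) ^ (N - j) * (r ^ 2) ^ (N - j) = 1 := by
      rw [← mul_pow, inv_mul_cancel₀ hr2, one_pow]
    calc (r ^ 2)⁻¹ ^ (N - j) * eval (fun i => x i) (homogeneousComponent (2 * j + b) P) * (r ^ 2) ^ (N - j)
        = ((r ^ 2)⁻¹ ^ (N - j) * (r ^ 2) ^ (N - j)) * eval (fun i => x i) (homogeneousComponent (2 * j + b) P) := by
          ring
      _ = eval (fun i => x i) (homogeneousComponent (2 * j + b) P) := by rw [h, one_mul]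
  have hE : (∑ j ∈ Finset.range (N + 1), He j * q ^ (N - j)) = 0 :=
    eq_zero_of_isHomogeneous_of_eval_sphere_eq_zero hhom hr hvan'
  -- descent
  have hHe0 := eq_zero_of_sum_mul_pow_nullForm_eq_zero N He hHe_harm hE
  intro j hj
  have h := hHe0 j hj
  rcases mul_eq_zero.mp h with h1 | h1
  · exfalso
    rw [C_eq_zero] at h1
    exact pow_ne_zero _ (inv_ne_zero hr2) h1
  · exact h1

/-- **A harmonic polynomial on `ℝ⁴` vanishing on a sphere of positive radius is zero** (CSF build-plan brick C1, spelled out and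
def-free).  See the module docstring for the proof. [cite: GoodmanWallachGTM255, §5.1.2 Lemma 5.1.5] -/
theorem eq_zero_of_laplacian_eq_zero_of_eval_sphere_eq_zero (P : MvPolynomial (Fin 4) ℝ)
    (hΔ : ∑ i, pderiv i (pderiv i P) = 0) (r : ℝ) (hr : 0 < r)
    (hS : ∀ x : EuclideanSpace ℝ (Fin 4), ‖x‖ = r → eval (fun i => x i) P = 0) : P = 0 := by
  set N : ℕ := P.totalDegree with hN
  -- components beyond the total degree vanish
  have hzero : ∀ k, N < k → homogeneousComponent k P = 0 := fun k hk => homogeneousComponent_eq_zero _ _ hk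
  -- `P` is the sum of its components up to `2N+1`
  have hP : (∑ k ∈ Finset.range (2 * (N + 1)), homogeneousComponent k P) = P := by
    have h0 : (∑ k ∈ Finset.range (N + 1), homogeneousComponent k P) = P := sum_homogeneousComponent P
    conv_rhs => rw [← h0]
    have hsub : Finset.range (N + 1) ⊆ Finset.range (2 * (N + 1)) := Finset.range_subset_range.2 (by omega)
    symm
    refine Finset.sum_subset hsub fun k hk hk' => ?_
    rw [Finset.mem_range] at hk hk'
    exact hzero k (by omega)
  -- (2) parity: even and odd parts vanish on the sphere
  have hparity : ∀ x : EuclideanSpace ℝ (Fin 4), ‖x‖ = r →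
      (∑ j ∈ Finset.range (N + 1), eval (fun i => x i) (homogeneousComponent (2 * j + 0) P)) = 0 ∧
      (∑ j ∈ Finset.range (N + 1), eval (fun i => x i) (homogeneousComponent (2 * j + 1) P)) = 0 := by
    intro x hx
    have h1 : (∑ k ∈ Finset.range (2 * (N + 1)), eval (fun i => x i) (homogeneousComponent k P)) = 0 := by
      rw [← map_sum, hP]
      exact hS x hx
    have h2 : (∑ k ∈ Finset.range (2 * (N + 1)), (-1 : ℝ) ^ k * eval (fun i => x i) (homogeneousComponent k P)) = 0 := by
      have hnx : ‖-x‖ = r := by rw [norm_neg, hx]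
      have h := hS (-x) hnx
      rw [← hP, map_sum] at h
      have hneg : (fun i => (-x) i) = fun i => -x i := by
        funext i
        rfl
      rw [hneg] at h
      rw [← h]
      refine Finset.sum_congr rfl fun k _ => ?_
      rw [eval_neg_of_isHomogeneous (homogeneousComponent_isHomogeneous k P)]
    rw [sum_range_two_mul] at h1 h2
    have he : ∀ j, (-1 : ℝ) ^ (2 * j) = 1 := fun j => by rw [pow_mul, neg_one_sq, one_pow]
    have ho : ∀ j, (-1 : ℝ) ^ (2 * j + 1) = -1 := fun j => by rw [pow_succ, he, one_mul]
    simp only [he, ho, one_mul, neg_one_mul, Finset.sum_neg_distrib] at h2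
    simp only [add_zero]
    constructor
    · linarith
    · linarith
  have heven := homogeneousComponent_eq_zero_of_parity P hΔ hr N 0 (fun x hx => (hparity x hx).1)
  have hodd := homogeneousComponent_eq_zero_of_parity P hΔ hr N 1 (fun x hx => (hparity x hx).2)
  -- (5) all components vanish
  rw [← hP]
  refine Finset.sum_eq_zero fun k hk => ?_
  rw [Finset.mem_range] at hk
  obtain ⟨j, hj | hj⟩ := Nat.even_or_odd' k
  · rw [hj]
    have := heven j (by omega)
    simpa using this
  · rw [hj]
    exact hodd j (by omega)

end Summit.QuantumFields.YangMills.Theorems.F4SubCurvatureDoorHarmonicSphere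

end
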